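import Mathlib.NumberTheory.NumberField.Completion.FinitePlace
import Mathlib.Analysis.SpecialFunctions.Log.Basic
import Mathlib.Algebra.CharP.Lemmas
import HarnessLib

/-!
# L-LANA objects VIII: the degree `deg` at a finite place and the local pilots of the `q`-pilot BPS (LANA §4.2 (c))

Record-only file (D-0012) of the abc-iut cell (seat abc-iut-c312-4, L-LANA level, plan/LLANA-SPEC N7);
TAKES NO SIDE on [IUTchIII] Cor. 3.12. `ForkHexagon.lean` (XIV) takes the local degrees `d_v > 0` of the
`q`-pilot value-group BPS as abstract positive reals (`LocalDegrees`). This file DEFINES them from a number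
field with Mathlib (`NumberField`, `FinitePlace`, `Ideal.absNorm`), following Project LANA's interim report
(bib `LANA2026Report`, read on the page), §4.2 (c) p. 26:

  "For each `v ∈ V^bad`, let us write one of the `2l`-th roots of `q_v` … as `q̲_v`. For an element
  `a ∈ O_{F_v}`, we define `deg(a) := [F:ℚ]⁻¹ log(#(O_{F_v}/a O_{F_v}))`. Using this, one can construct a
  value-group BPS as follows: • put `C := ℝ`; • for each `v ∈ V`, define the local pilot `φ_v ∈ C` at `v` by
  `φ_v = deg(q̲_v)` (`v ∈ V^bad`); `deg(p_v)` (`v ∈ V^good ∩ V^non`); `2π` (`v ∈ V^arc`)."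

* `placeDeg F v a := −[F:ℚ]⁻¹ · log ‖a‖_v` for `a ∈ F` at a finite place `v`, where `‖·‖_v` is Mathlib's
  `absNorm`-normalised absolute value (`FinitePlace.mk v`; `‖a‖_v = N(v)^{−ord_v(a)}`), so that for an
  integer `a` this IS `[F:ℚ]⁻¹ log #(O_F / v^{ord_v(a)})` = the printed `[F:ℚ]⁻¹ log #(O_{F_v}/a O_{F_v})`
  (`placeDeg_eq_log_absNorm`); additivity `placeDeg_mul`; `placeDeg_nonneg` on integers; `placeDeg_pos` on
  nonzero elements of `v`.
* `residueChar v = p_v` (the characteristic of `O_F/v`), `residueChar_mem` (`p_v ∈ v`), `degP v = deg(p_v)`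
  with `degP_pos`.
* `degOfOrd v r := [F:ℚ]⁻¹ · r · log N(v)`, the degree of an element of `v`-order `r` — used for the ROOT
  `q̲_v` (order `ord_v(q_v)/(2l)`, generally not an element of `F_v`): `qPilotBad`, with `qPilotBad_pos`;
  `qPilotArc := 2π`. These are the `d_v` of XIV (`LocalDegrees.d`, `d_pos`); the one datum not constructed
  is `ord_v(q_v) > 0` — the `q`-parameter of the Tate curve `E_v` at a place of bad multiplicative reduction
  ([IUTchI] Def. 3.1 (b); abc-iut FOUNDATIONS row 8, Tate uniformisation as FACT; seat abc-iut-L5-t2).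

Modelling notes. (i) LANA's `V` is a set of places of the extension field `K` mapping bijectively to
`V_mod` (§2, §3.1); the degree is normalised by `[F:ℚ]` and computed in `F_v` as printed — the number field
whose places are used is the parameter `F` here. (ii) `2π` at archimedean places is a constant.
NOT here: the value-group BPS itself (XIV `LocalDegrees.qBPS`, to be instantiated by a short bridge once XIV
is in the tree), `q`-parameters, any judgement.
-/

noncomputable section

namespace Summit.ABC
namespace IUTFork

open NumberField IsDedekindDomain

variable (F : Type) [Field F] [NumberField F]

/-! ## 1. `deg` at a finite place -/

/-- **LANA §4.2 (c)**: "`deg(a) := [F:ℚ]⁻¹ log(#(O_{F_v}/a O_{F_v}))`", typed for `a ∈ F` at the finite place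
`v` as `−[F:ℚ]⁻¹ · log ‖a‖_v` with `‖·‖_v` the `N(v)`-normalised absolute value (equal to the printed
expression on integers: `placeDeg_eq_log_absNorm`). [cite: LANA2026Report, §4.2 (c) p. 26] -/
def placeDeg (v : HeightOneSpectrum (𝓞 F)) (a : F) : ℝ :=
  -((Module.finrank ℚ F : ℝ)⁻¹ * Real.log (FinitePlace.mk v a))

variable {F}

/-- `[F:ℚ] > 0`. [folklore] -/
theorem finrank_pos_real : 0 < (Module.finrank ℚ F : ℝ) := by exact_mod_cast Module.finrank_pos

/-- `deg` is additive on nonzero elements: `deg(ab) = deg(a) + deg(b)`. [cite: LANA2026Report, §4.2 (c) p. 26] -/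
theorem placeDeg_mul (v : HeightOneSpectrum (𝓞 F)) {a b : F} (ha : a ≠ 0) (hb : b ≠ 0) :
    placeDeg F v (a * b) = placeDeg F v a + placeDeg F v b := by
  have ha' : 0 < FinitePlace.mk v a := FinitePlace.pos_iff.mpr ha
  have hb' : 0 < FinitePlace.mk v b := FinitePlace.pos_iff.mpr hb
  rw [placeDeg, placeDeg, placeDeg, map_mul, Real.log_mul ha'.ne' hb'.ne']
  ring

/-- On integers `deg ≥ 0` (`‖a‖_v ≤ 1`). [cite: LANA2026Report, §4.2 (c) p. 26] -/
theorem placeDeg_nonneg (v : HeightOneSpectrum (𝓞 F)) (x : 𝓞 F) : 0 ≤ placeDeg F v (x : F) := by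
  rw [placeDeg, neg_nonneg]
  refine mul_nonpos_of_nonneg_of_nonpos (inv_nonneg.mpr finrank_pos_real.le) ?_
  rw [FinitePlace.mk_apply]
  exact Real.log_nonpos (norm_nonneg _) (FinitePlace.norm_le_one F v x)

/-- On nonzero elements of `v`, `deg > 0` (`0 < ‖a‖_v < 1`): the local pilots are POSITIVE.
[cite: LANA2026Report, §4.2 (c) p. 26] -/
theorem placeDeg_pos (v : HeightOneSpectrum (𝓞 F)) {x : 𝓞 F} (hx : x ∈ v.asIdeal) (hx0 : x ≠ 0) :
    0 < placeDeg F v (x : F) := by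
  rw [placeDeg, neg_pos]
  refine mul_neg_of_pos_of_neg (inv_pos.mpr finrank_pos_real) ?_
  rw [FinitePlace.mk_apply]
  refine Real.log_neg ?_ ((FinitePlace.norm_lt_one_iff_mem F v x).mpr hx)
  rw [← FinitePlace.mk_apply]
  exact FinitePlace.pos_iff.mpr
    ((map_ne_zero_iff (algebraMap (𝓞 F) F) (FaithfulSMul.algebraMap_injective (𝓞 F) F)).mpr hx0)

/-- **The printed form**: for a nonzero integer `a`, `deg(a) = [F:ℚ]⁻¹ · log #(O_F / v^{ord_v(a)})`
(`= [F:ℚ]⁻¹ log #(O_{F_v}/a O_{F_v})`), via `‖a‖_v · N(v^{ord_v(a)}) = 1`.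
[cite: LANA2026Report, §4.2 (c) p. 26] -/
theorem placeDeg_eq_log_absNorm (v : HeightOneSpectrum (𝓞 F)) {x : 𝓞 F} (hx0 : x ≠ 0) :
    placeDeg F v (x : F) =
      (Module.finrank ℚ F : ℝ)⁻¹ * Real.log (Ideal.absNorm (v.maxPowDividing (Ideal.span {x}))) := by
  have h := HeightOneSpectrum.embedding_mul_absNorm v (K := F) hx0
  have hpos : 0 < ‖FinitePlace.embedding v (algebraMap (𝓞 F) F x)‖ := by
    rw [← FinitePlace.mk_apply]
    exact FinitePlace.pos_iff.mpr
      ((map_ne_zero_iff (algebraMap (𝓞 F) F) (FaithfulSMul.algebraMap_injective (𝓞 F) F)).mpr hx0)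
  have hN : 0 < (Ideal.absNorm (v.maxPowDividing (Ideal.span {x})) : ℝ) :=
    (mul_pos_iff_of_pos_left hpos).mp (by rw [h]; exact one_pos)
  have hlog := congrArg Real.log h
  rw [Real.log_mul hpos.ne' hN.ne', Real.log_one] at hlog
  rw [placeDeg, FinitePlace.mk_apply]
  change -((Module.finrank ℚ F : ℝ)⁻¹ * Real.log ‖FinitePlace.embedding v (algebraMap (𝓞 F) F x)‖) = _
  rw [show Real.log (Ideal.absNorm (v.maxPowDividing (Ideal.span {x})) : ℝ) =
      -Real.log ‖FinitePlace.embedding v (algebraMap (𝓞 F) F x)‖ by linarith]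
  ring

/-! ## 2. `deg(p_v)` at a good nonarchimedean place -/

/-- The residue characteristic `p_v` of the finite place `v` (the characteristic of `O_F/v`).
[cite: LANA2026Report, §4.2 (b) p. 25] -/
def residueChar (v : HeightOneSpectrum (𝓞 F)) : ℕ := ringChar (𝓞 F ⧸ v.asIdeal)

omit [NumberField F] in
/-- `p_v ∈ v`. [folklore] -/
theorem residueChar_mem (v : HeightOneSpectrum (𝓞 F)) : (residueChar v : 𝓞 F) ∈ v.asIdeal := by
  rw [← Ideal.Quotient.eq_zero_iff_mem, map_natCast]
  exact ringChar.Nat.cast_ringChar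

/-- `p_v ≠ 0` (the residue ring is finite). [folklore] -/
theorem residueChar_ne_zero (v : HeightOneSpectrum (𝓞 F)) : residueChar v ≠ 0 := by
  haveI : Finite (𝓞 F ⧸ v.asIdeal) := Ideal.finiteQuotientOfFreeOfNeBot v.asIdeal v.ne_bot
  exact CharP.ringChar_ne_zero_of_finite (𝓞 F ⧸ v.asIdeal)

/-- **§4.2 (c)**: the local pilot "`deg(p_v)` (`v ∈ V^good ∩ V^non`)". [cite: LANA2026Report, §4.2 (c) p. 26] -/
def degP (v : HeightOneSpectrum (𝓞 F)) : ℝ := placeDeg F v (residueChar v : F)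

/-- `deg(p_v) > 0`. [cite: LANA2026Report, §4.2 (c) p. 26] -/
theorem degP_pos (v : HeightOneSpectrum (𝓞 F)) : 0 < degP v := by
  have h := placeDeg_pos v (residueChar_mem v) (by exact_mod_cast residueChar_ne_zero v)
  simpa [degP] using h

/-! ## 3. `deg(q̲_v)` at a bad place and the three kinds of local pilots -/

/-- The degree of an element of `v`-ORDER `r`: `[F:ℚ]⁻¹ · r · log N(v)` (`N(v) = #(O_F/v)`); for an integer
of order `n` this is `placeDeg` (`#(O_F/v^n) = N(v)^n`), and it makes sense for the root `q̲_v` of order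
`ord_v(q_v)/(2l)`. [cite: LANA2026Report, §4.2 (c) p. 26] -/
def degOfOrd (v : HeightOneSpectrum (𝓞 F)) (r : ℝ) : ℝ :=
  (Module.finrank ℚ F : ℝ)⁻¹ * r * Real.log (Ideal.absNorm v.asIdeal)

/-- `log N(v) > 0` (`N(v) > 1`). [folklore] -/
theorem log_absNorm_pos (v : HeightOneSpectrum (𝓞 F)) : 0 < Real.log (Ideal.absNorm v.asIdeal : ℝ) :=
  Real.log_pos (by exact_mod_cast HeightOneSpectrum.one_lt_absNorm v)

/-- Positive order, positive degree. [folklore] -/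
theorem degOfOrd_pos (v : HeightOneSpectrum (𝓞 F)) {r : ℝ} (hr : 0 < r) : 0 < degOfOrd v r :=
  mul_pos (mul_pos (inv_pos.mpr finrank_pos_real) hr) (log_absNorm_pos v)

/-- **§4.2 (c)**: the local pilot "`φ_v = deg(q̲_v)` (`v ∈ V^bad`)", `q̲_v` a `2l`-th root of the `q`-parameter
`q_v`: the degree of order `ord_v(q_v)/(2l)`. INPUT: `ord_v(q_v)` (Tate parameter of `E_v`; FOUNDATIONS
row 8). [cite: LANA2026Report, §4.2 (c) p. 26] -/
def qPilotBad (v : HeightOneSpectrum (𝓞 F)) (l ordq : ℕ) : ℝ := degOfOrd v ((ordq : ℝ) / (2 * l))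

/-- `deg(q̲_v) > 0` at a place of bad (multiplicative) reduction (`ord_v(q_v) > 0`, `l > 0`).
[cite: LANA2026Report, §4.2 (c) p. 26] -/
theorem qPilotBad_pos (v : HeightOneSpectrum (𝓞 F)) {l ordq : ℕ} (hl : 0 < l) (hq : 0 < ordq) :
    0 < qPilotBad v l ordq :=
  degOfOrd_pos v (div_pos (by exact_mod_cast hq) (by positivity))

/-- `deg(q̲_v) = deg(q_v)/(2l)`: the root carries `1/(2l)` of the degree of `q_v`.
[cite: LANA2026Report, §4.2 (c) p. 26] -/
theorem qPilotBad_eq_div (v : HeightOneSpectrum (𝓞 F)) (l ordq : ℕ) (hl : 0 < l) :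
    qPilotBad v l ordq = degOfOrd v ordq / (2 * l) := by
  rw [qPilotBad, degOfOrd, degOfOrd]
  field_simp

/-- **§4.2 (c)**: the local pilot "`2π` (`v ∈ V^arc`)". [cite: LANA2026Report, §4.2 (c) p. 26] -/
def qPilotArc : ℝ := 2 * Real.pi

/-- `2π > 0`. [folklore] -/
theorem qPilotArc_pos : 0 < qPilotArc := by unfold qPilotArc; positivity

/-! ## 4. The `q`-pilot local degrees over a set of places `V = V^bad ⊔ (V^good ∩ V^non) ⊔ V^arc` -/

/-- INPUT for the `q`-pilot value-group BPS of §4.2 (c): `l`, finite sets of bad and good nonarchimedean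
places of `F`, the number of archimedean places in `V`, and the orders `ord_v(q_v) > 0` of the
`q`-parameters at the bad places (Tate uniformisation, [IUTchI] Def. 3.1 (b): data here).
[cite: LANA2026Report, §4.2 (c) p. 26] -/
structure QPilotInput (F : Type) [Field F] [NumberField F] : Type where
  /-- the prime `l` of the initial Θ-data -/
  l : ℕ
  /-- `l ≥ 5` -/
  five_le : 5 ≤ l
  /-- `V^bad` -/
  bad : Finset (HeightOneSpectrum (𝓞 F))
  /-- `V^bad ≠ ∅` -/
  bad_nonempty : bad.Nonempty
  /-- `V^good ∩ V^non` (the chosen good finite places) -/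
  good : Finset (HeightOneSpectrum (𝓞 F))
  /-- `#V^arc` -/
  nArc : ℕ
  /-- `ord_v(q_v)` -/
  ordq : HeightOneSpectrum (𝓞 F) → ℕ
  /-- bad multiplicative reduction: `ord_v(q_v) > 0` on `V^bad` -/
  ordq_pos : ∀ v ∈ bad, 0 < ordq v

namespace QPilotInput

variable (Q : QPilotInput F)

/-- The index type of places `V = V^bad ⊔ V^good ⊔ V^arc`. [cite: LANA2026Report, §4.2 (c) p. 26] -/
abbrev V : Type := (↥Q.bad ⊕ ↥Q.good) ⊕ Fin Q.nArc

/-- **The local pilots `φ_v = d_v`** of the `q`-pilot value-group BPS (`C = ℝ`): `deg(q̲_v)` / `deg(p_v)` /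
`2π`. [cite: LANA2026Report, §4.2 (c) p. 26] -/
def d : Q.V → ℝ
  | Sum.inl (Sum.inl v) => qPilotBad v.1 Q.l (Q.ordq v.1)
  | Sum.inl (Sum.inr v) => degP v.1
  | Sum.inr _ => qPilotArc

/-- **Every local pilot is positive** — the hypothesis `LocalDegrees.d_pos` of XIV, discharged for the
printed pilots. [cite: LANA2026Report, §4.2 (c) p. 26] -/
theorem d_pos (v : Q.V) : 0 < Q.d v := by
  rcases v with (v | v) | i
  · exact qPilotBad_pos v.1 (by linarith [Q.five_le]) (Q.ordq_pos v.1 v.2)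
  · exact degP_pos v.1
  · exact qPilotArc_pos

/-- The bad places inside `V`. [cite: LANA2026Report, §4.2 (c) p. 26] -/
def badIn : Finset Q.V := Finset.univ.map ⟨fun v => Sum.inl (Sum.inl v), fun _ _ h => by simpa using h⟩

/-- `V^bad ≠ ∅` inside `V` (XIV `LocalDegrees.bad_nonempty`). [cite: LANA2026Report, §4.2 (c) p. 26] -/
theorem badIn_nonempty : Q.badIn.Nonempty := by
  obtain ⟨v, hv⟩ := Q.bad_nonempty
  exact ⟨Sum.inl (Sum.inl ⟨v, hv⟩), Finset.mem_map.mpr ⟨⟨v, hv⟩, Finset.mem_univ _, rfl⟩⟩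

/-- The pilot `φ_C = Σ_{v ∈ V^bad} φ_v` is positive (in particular nonzero: Def. 4.1.3's condition).
[cite: LANA2026Report, Def. 4.1.3 p. 24, §4.2 (c) p. 26] -/
theorem pilot_pos : 0 < ∑ v ∈ Q.badIn, Q.d v :=
  Finset.sum_pos (fun v _ => Q.d_pos v) Q.badIn_nonempty

/-- `ℓ⋇ = (l − 1)/2 ≥ 2` for `l ≥ 5` (XIV `LocalDegrees.two_le_lstar`). [folklore] -/
theorem two_le_lstar : 2 ≤ (Q.l - 1) / 2 := by
  have := Q.five_le
  omega

end QPilotInput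

end IUTFork

end Summit.ABC

end
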